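import Literature.Probability.Percolation.TriQuadStages
import Literature.Probability.Percolation.StoppingSetDecoupling
import Literature.Probability.Percolation.TriForcedFrame
import HarnessLib

/-!
# Protected extremities of the successive lowest crossings

Topic `Literature/Probability/Percolation`; family `crit-perc`, statement **crit-perc.S16**
(`Literature.Probability.Percolation.triTheta_exponent`). Assembly of the protection step of
Kesten's arm separation in P. Nolin's form (EJP 13 (2008), §4.4, proof of Lemma 15
[arXiv 0711.4948: Lemma 14]) for an abstract lattice quad `Q` (`TriQuad`) and the iteration
`Q.stages` of `TriQuadStages.lean`:

> "Consider some `u ∈ {1, …, T}` […]. The event `E_u` is independent from the status of the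
> sites above `c̃_u`. Hence, if we condition on `E_u`, percolation there remains unbiased and we
> can use the RSW theorem. […] we observe a white circuit in one of the annuli […], preventing
> other disjoint black crossings to arrive near `z_u` […]. Summing over all possibilities for
> `c̃_i`, `σ̃_i`, we get that `P(t ≥ u and c_u is not protected from above) ≤ (1-δ'')^{-C'''₄ log η}`."

* `Q.openStop ω u = N_u ∪ explored (ω \ N_u)` — the sites examined once the lowest *open*
  crossing of stage `u + 1` has been explored; a stopping set (`isStoppingSet_openStop`), between
  `N_u` and `N_{u+1}`.
* `Q.canonSet ω u` — the open sites of that explored set off `N_u` (the set carrying the lowest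
  open crossing avoiding `N_u`); it only depends on the data of `openStop` (`canonSet_eq_of_agree`);
  `canonStart S` — a canonical starting site (on `L`) of a crossing inside a set `S`, with its tight
  support `canonSupport S` (`canonSupport_spec`).
* `Q.ProtO K M₀ ω u` — **the open extremity of stage `u + 1` is protected**: for some `i < K` the
  frame of scale `3^i M₀` around `canonStart (canonSet ω u)` is open once the sites of
  `openStop ω u` and the sites off `U` are forced open (`triForcedFrame`, `TriForcedFrame.lean`).
  `real_not_protO_le`: **`P_p(not protected) ≤ (1 - c₀⁴)^K`** whenever
  `P_p(LR(4·3^i M₀, 3^i M₀)) ≥ c₀` for `i < K` (decoupling along the stopping set,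
  `real_mem_dataEvent_le`, and `real_iInter_compl_triForcedFrame_le_pow`) — no conditioning.
* `not_pathIn_closed_of_protO` — on `ProtO`, no path of closed sites of `U` avoiding
  `openStop ω u` joins the `3^i M₀`-neighbourhood of the protected extremity to distance
  `2 · 3^i M₀` ("preventing other disjoint crossings to arrive near `z_u`"); in particular every
  closed crossing avoiding `openStop ω u` starts at sup-distance at least `M₀` from it
  (`dist_ge_of_protO`).
The closed extremities are handled by colour exchange (`ProtO` for `ωᶜ`; `stages_compl`).

## References

* P. Nolin, Near-critical percolation in two dimensions, *Electron. J. Probab.* 13 (2008), §4.4,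
  proof of Lemma 15 [arXiv 0711.4948: Lemma 14] [Nolin2008].
* H. Kesten, Scaling relations for 2D-percolation, *Comm. Math. Phys.* 109 (1987), proof of
  Lemma 2 [KestenScalingCMP1987].

## Mathlib / tree

Tree: `TriQuad.stages`, `TriQuad.stage`, `TriQuad.isStoppingSet_stages`, `TriQuad.mem_stage`
(`TriQuadStages.lean`), `TriQuad.explored`, `TriQuad.isStoppingSet_explored`, `TriQuad.LRPath`
(`TriLowestCrossingSwitch.lean`), `dataPiece`, `real_mem_dataEvent_le`
(`StoppingSetDecoupling.lean`), `triForcedFrame`, `determinedBy_triForcedFrame`,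
`real_iInter_compl_triForcedFrame_le_pow`, `not_pathIn_closed_of_triForcedFrame`, `DeterminedBy.compl`
(`TriForcedFrame.lean`), `PathIn.exists_support`.
-/

noncomputable section

open MeasureTheory Set

namespace Literature.Probability.Percolation

open LatticeModels

namespace TriQuad

variable {Q : TriQuad}

/-! ### The stopping set of the lowest open crossing of a stage -/

variable (Q) in
/-- **The examined set after exploring the lowest open crossing avoiding `N_u`**:
`N_u ∪ explored (ω \ N_u)` (between `N_u` and `N_{u+1}`). [cite: Nolin2008, §4.4, proof of Lemma 15 (the events E_u; arXiv 0711.4948: Lemma 14)] -/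
def openStop (ω : Set (Site 2)) (u : ℕ) : Finset (Site 2) :=
  Q.stages ω u ∪ Q.explored (ω \ ↑(Q.stages ω u))

/-- `N_u ⊆ openStop ω u`. [folklore] -/
theorem stages_subset_openStop (ω : Set (Site 2)) (u : ℕ) : Q.stages ω u ⊆ Q.openStop ω u := by
  classical
  exact Finset.subset_union_left

/-- `explored (ω \ N_u) ⊆ openStop ω u`. [folklore] -/
theorem explored_subset_openStop (ω : Set (Site 2)) (u : ℕ) :
    Q.explored (ω \ ↑(Q.stages ω u)) ⊆ Q.openStop ω u := by
  classical
  exact Finset.subset_union_right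

/-- `openStop ω u ⊆ N_{u+1}`. [folklore] -/
theorem openStop_subset_stages_succ (ω : Set (Site 2)) (u : ℕ) : Q.openStop ω u ⊆ Q.stages ω (u + 1) := by
  classical
  intro v hv
  rw [stages_succ]
  rcases Finset.mem_union.1 hv with hv | hv
  · exact mem_stage.2 (Or.inl hv)
  · exact mem_stage.2 (Or.inr (Or.inl hv))

/-- `openStop ω u ⊆ U`. [folklore] -/
theorem openStop_subset (ω : Set (Site 2)) (u : ℕ) : Q.openStop ω u ⊆ Q.U :=
  (openStop_subset_stages_succ ω u).trans (stages_subset ω (u + 1))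

variable (Q) in
/-- **`openStop · u` is a stopping set.** [cite: Nolin2008, §4.4, proof of Lemma 15 ("E_u is independent from the status of the sites above c_u"; arXiv 0711.4948: Lemma 14)] -/
theorem isStoppingSet_openStop (u : ℕ) : IsStoppingSet fun ω => Q.openStop ω u := by
  classical
  intro ω ω' h
  have hN : Q.stages ω' u = Q.stages ω u :=
    Q.isStoppingSet_stages u ω ω' fun v hv => h v (stages_subset_openStop ω u hv)
  have hE : Q.explored (ω' \ ↑(Q.stages ω u)) = Q.explored (ω \ ↑(Q.stages ω u)) :=
    Q.isStoppingSet_explored _ _ fun v hv => by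
      have := h v (explored_subset_openStop ω u hv)
      simp only [mem_sdiff, this]
  show Q.stages ω' u ∪ Q.explored (ω' \ ↑(Q.stages ω' u)) = Q.stages ω u ∪ Q.explored (ω \ ↑(Q.stages ω u))
  rw [hN, hE]

/-! ### The canonical open crossing of a stage -/

variable (Q) in
/-- **The set carrying the lowest open crossing avoiding `N_u`**: the open sites of
`explored (ω \ N_u)` off `N_u`, inside `U`. [cite: Nolin2008, §4.4, proof of Lemma 15 (arXiv 0711.4948: Lemma 14)] -/
def canonSet (ω : Set (Site 2)) (u : ℕ) : Set (Site 2) :=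
  ↑Q.U ∩ (ω \ ↑(Q.stages ω u)) ∩ ↑(Q.explored (ω \ ↑(Q.stages ω u)))

/-- The canonical set only depends on the data of `openStop`: configurations agreeing on
`openStop ω u` have the same canonical set. [folklore] -/
theorem canonSet_eq_of_agree {ω ω' : Set (Site 2)} {u : ℕ} (h : ∀ v ∈ Q.openStop ω u, v ∈ ω ↔ v ∈ ω') :
    Q.canonSet ω' u = Q.canonSet ω u := by
  have hN : Q.stages ω' u = Q.stages ω u :=
    Q.isStoppingSet_stages u ω ω' fun v hv => h v (stages_subset_openStop ω u hv)
  have hE : Q.explored (ω' \ ↑(Q.stages ω u)) = Q.explored (ω \ ↑(Q.stages ω u)) :=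
    Q.isStoppingSet_explored _ _ fun v hv => by
      have := h v (explored_subset_openStop ω u hv)
      simp only [mem_sdiff, this]
  unfold canonSet
  rw [hN, hE]
  ext z
  simp only [mem_inter_iff, mem_sdiff, Finset.mem_coe]
  constructor
  · rintro ⟨⟨hzU, hzω', hzN⟩, hzE⟩
    exact ⟨⟨hzU, (h z (explored_subset_openStop ω u hzE)).2 hzω', hzN⟩, hzE⟩
  · rintro ⟨⟨hzU, hzω, hzN⟩, hzE⟩
    exact ⟨⟨hzU, (h z (explored_subset_openStop ω u hzE)).1 hzω, hzN⟩, hzE⟩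

/-- If an open crossing avoids `N_u`, the canonical set carries an `L–R` crossing. [cite: Nolin2008, §4.4, proof of Lemma 15 (arXiv 0711.4948: Lemma 14)] -/
theorem exists_crossing_canonSet {ω : Set (Site 2)} {u : ℕ} (h : Q.LRPath (ω \ ↑(Q.stages ω u))) :
    ∃ x ∈ Q.L, ∃ y ∈ Q.R, PathIn triGraph (Q.canonSet ω u) x y := by
  obtain ⟨x, hx, y, hy, hp⟩ := exists_lr_subset_explored h
  exact ⟨x, hx, y, hy, hp.mono fun z hz => ⟨⟨hz.1, hz.2.1⟩, hz.2.2⟩⟩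

variable (Q) in
/-- The crossings of a set of sites, packaged with a tight support **meeting `L` only at its
start** (the "tip" on the inner arc; Nolin's extremity `z_u`). [folklore] -/
def HasCanon (S : Set (Site 2)) : Prop :=
  ∃ x : Site 2, ∃ T : Set (Site 2), ∃ y : Site 2, x ∈ Q.L ∧ y ∈ Q.R ∧ T ⊆ S ∧ PathIn triGraph T x y ∧
    (∀ z ∈ T, PathIn triGraph T x z) ∧ ∀ z ∈ T, z ∈ Q.L → z = x

/-- A crossing inside `S` gives canonical data: cut the path at its last visit to `L`, then take a
tight support. [folklore] -/
theorem hasCanon_of_pathIn {S : Set (Site 2)} {x y : Site 2} (hx : x ∈ Q.L) (hy : y ∈ Q.R)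
    (hp : PathIn triGraph S x y) : Q.HasCanon S := by
  -- the sub-path after the last visit to `L`
  have key : ∃ x' ∈ Q.L, ∃ S' ⊆ S, PathIn triGraph S' x' y ∧ ∀ z ∈ S', z ∈ Q.L → z = x' := by
    rcases hp.last_exit_or (C := (↑Q.L : Set (Site 2))) (show x ∈ (↑Q.L : Set (Site 2)) from hx) with
      hyL | ⟨a, b, haL, haS, hbL, hab, htail⟩
    · exact ⟨y, hyL, {y}, by simpa using hp.right_mem, PathIn.refl rfl, fun z hz _ => hz⟩
    · refine ⟨a, haL, insert a (S \ ↑Q.L), ?_, ?_, ?_⟩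
      · exact Set.insert_subset haS Set.sdiff_subset
      · exact ((PathIn.refl (Set.mem_insert a _)).tail hab (Set.mem_insert_of_mem _ htail.left_mem)).trans
          (htail.mono (Set.subset_insert _ _))
      · rintro z (rfl | hz) hzL
        · rfl
        · exact absurd (show z ∈ (↑Q.L : Set (Site 2)) from hzL) hz.2
  obtain ⟨x', hx', S', hS', hp', honly⟩ := key
  obtain ⟨T, hT, hTp, hTall⟩ := hp'.exists_support
  exact ⟨x', T, y, hx', hy, hT.trans hS', hTp, hTall, fun z hz hzL => honly z (hT hz) hzL⟩

open Classical in
variable (Q) in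
/-- **The canonical starting site** (tip on `L`) of a crossing inside `S` (an arbitrary but fixed
choice; `0` if there is none). Being a function of the set `S` alone, it is a function of the
explored data. [cite: Nolin2008, §4.4, proof of Lemma 15 (the extremities z_u; arXiv 0711.4948: Lemma 14)] -/
def canonStart (S : Set (Site 2)) : Site 2 :=
  if h : Q.HasCanon S then h.choose else 0

open Classical in
variable (Q) in
/-- The tight support of the canonical crossing inside `S` (`∅` if there is none). [folklore] -/
def canonSupport (S : Set (Site 2)) : Set (Site 2) :=
  if h : Q.HasCanon S then h.choose_spec.choose else ∅

/-- **Specification of the canonical crossing**: if `S` carries a crossing, `canonSupport S ⊆ S`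
is the tight support of an `L–R` crossing starting at `canonStart S ∈ L` and meeting `L` only
there. [folklore] -/
theorem canonSupport_spec {S : Set (Site 2)} (h : Q.HasCanon S) :
    Q.canonStart S ∈ Q.L ∧ Q.canonSupport S ⊆ S ∧
      (∃ y ∈ Q.R, PathIn triGraph (Q.canonSupport S) (Q.canonStart S) y) ∧
      (∀ z ∈ Q.canonSupport S, PathIn triGraph (Q.canonSupport S) (Q.canonStart S) z) ∧
      ∀ z ∈ Q.canonSupport S, z ∈ Q.L → z = Q.canonStart S := by
  classical
  have hs := h.choose_spec.choose_spec
  obtain ⟨y, hx, hy, hT, hp, hall, honly⟩ := hs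
  simp only [canonStart, canonSupport, dif_pos h]
  exact ⟨hx, hT, ⟨y, hy, hp⟩, hall, honly⟩

/-! ### Protection of the open extremity -/

variable (Q) in
/-- **The open extremity of stage `u + 1` is protected** (at `K` scales from `M₀`): for some
`i < K`, the frame of scale `3^i M₀` around `canonStart (canonSet ω u)` is open in the
configuration where the sites of `openStop ω u` and the sites off `U` are forced open. [cite: Nolin2008, §4.4, proof of Lemma 15 ("c_u is protected from above"; arXiv 0711.4948: Lemma 14)] -/
def ProtO (K M₀ : ℕ) (ω : Set (Site 2)) (u : ℕ) : Prop :=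
  ∃ i < K, ω ∈ triForcedFrame (↑(Q.openStop ω u) ∪ (↑Q.U)ᶜ) (Q.canonStart (Q.canonSet ω u)) (3 ^ i * M₀)

/-- **Unprotected extremities are rare**: `P_p({ω | ¬ ProtO K M₀ ω u}) ≤ (1 - c₀⁴)^K` whenever
`c₀ ≤ P_p(LR(4 · 3^i M₀, 3^i M₀))` for all `i < K` (`M₀ ≥ 1`, `0 ≤ c₀`). Proof: decouple along the
stopping set `openStop · u` (`real_mem_dataEvent_le`); for fixed data the complement of
protection is the failure of `K` forced frames around a fixed site, of probability at most
`(1 - c₀⁴)^K` (`real_iInter_compl_triForcedFrame_le_pow`). Nolin: "Summing over all possibilities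
for `c̃_i`, `σ̃_i` … `P(t ≥ u and c_u is not protected from above) ≤ (1-δ'')^{-C₄ log η}`." [cite: Nolin2008, §4.4, proof of Lemma 15 (arXiv 0711.4948: Lemma 14)] [cite: KestenScalingCMP1987, proof of Lemma 2] -/
theorem real_not_protO_le (p : unitInterval) (K : ℕ) {M₀ : ℕ} (hM₀ : 1 ≤ M₀) (u : ℕ) {c₀ : ℝ}
    (hc₀ : 0 ≤ c₀) (hc₀1 : c₀ ≤ 1) (hrsw : ∀ i < K, c₀ ≤ triLRCrossingProb p (4 * (3 ^ i * M₀)) (3 ^ i * M₀)) :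
    (triSitePercolation p).real {ω | ¬ Q.ProtO K M₀ ω u} ≤ (1 - c₀ ^ 4) ^ K := by
  classical
  -- the data-indexed events: reference configuration `↑η` for the data `(F, η)`
  set A : Finset (Site 2) → Finset (Site 2) → Set (Set (Site 2)) := fun F η =>
    ⋂ i < K, (triForcedFrame (↑F ∪ (↑Q.U)ᶜ) (Q.canonStart (Q.canonSet (↑η) u)) (3 ^ i * M₀))ᶜ with hA
  have hsub : {ω : Set (Site 2) | ¬ Q.ProtO K M₀ ω u} ⊆
      {ω | ω ∈ A (Q.openStop ω u) ((Q.openStop ω u).filter (· ∈ ω))} := by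
    intro ω hω
    have hagree : ∀ v ∈ Q.openStop ω u, v ∈ ω ↔ v ∈ (↑((Q.openStop ω u).filter (· ∈ ω)) : Set (Site 2)) :=
      fun v hv => by simp [hv]
    have hc : Q.canonSet (↑((Q.openStop ω u).filter (· ∈ ω))) u = Q.canonSet ω u := canonSet_eq_of_agree hagree
    simp only [hA, mem_setOf_eq, mem_iInter, mem_compl_iff, hc]
    intro i hi hmem
    exact hω ⟨i, hi, hmem⟩
  refine (measureReal_mono hsub (measure_ne_top _ _)).trans ?_
  unfold triSitePercolation
  have hε : 0 ≤ (1 - c₀ ^ 4) ^ K := pow_nonneg (sub_nonneg.2 (pow_le_one₀ hc₀ hc₀1)) K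
  refine real_mem_dataEvent_le p (G := Q.U) (Q.isStoppingSet_openStop u) (fun ω => openStop_subset ω u) A
    (fun F η => ?_) hε fun F η => ?_
  · -- determined by the frame sites off `F ∪ Uᶜ`, a finite set disjoint from `F`
    refine ⟨((Finset.range K).biUnion fun i =>
      triSqAnnulusFinset (Q.canonStart (Q.canonSet (↑η) u)) (3 ^ i * M₀) (2 * (3 ^ i * M₀))) \ F, Finset.sdiff_disjoint.symm, ?_⟩
    simp only [hA]
    refine DeterminedBy.iInter fun i => DeterminedBy.iInter fun hi => ?_
    have hdet := (determinedBy_triForcedFrame ((↑F : Set (Site 2)) ∪ (↑Q.U)ᶜ)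
      (Q.canonStart (Q.canonSet (↑η) u)) (3 ^ i * M₀)).compl
    rw [Finset.coe_filter] at hdet
    refine hdet.mono ?_
    rintro z ⟨hz, hzD⟩
    rw [Finset.coe_sdiff, Finset.coe_biUnion]
    refine ⟨Set.mem_biUnion (Finset.mem_coe.2 (Finset.mem_range.2 hi)) (Finset.mem_coe.2 hz), fun hzF => hzD (Or.inl hzF)⟩
  · have := real_iInter_compl_triForcedFrame_le_pow p ((↑F : Set (Site 2)) ∪ (↑Q.U)ᶜ)
      (Q.canonStart (Q.canonSet (↑η) u)) hM₀ K hc₀ hrsw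
    unfold triSitePercolation at this
    simpa only [hA] using this

/-- **Protection blocks closed crossings near the extremity**: on `ProtO`, with `i` the protecting
scale, no `𝕋`-path of `ω`-closed sites of `U` avoiding `openStop ω u` joins a site at sup-distance
`≤ 3^i M₀` from the extremity to a site at sup-distance `≥ 2 · 3^i M₀` from it. [cite: Nolin2008, §4.4, proof of Lemma 15 ("preventing other disjoint crossings to arrive near z_u"; arXiv 0711.4948: Lemma 14)] -/
theorem not_pathIn_closed_of_protO {K M₀ : ℕ} (hM₀ : 1 ≤ M₀) {ω : Set (Site 2)} {u : ℕ}
    (h : Q.ProtO K M₀ ω u) :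
    ∃ i < K, ∀ {A : Set (Site 2)} {s t : Site 2}, A ⊆ (↑Q.U ∩ ωᶜ) \ ↑(Q.openStop ω u) →
      (Q.canonStart (Q.canonSet ω u) 0 - ((3 ^ i * M₀ : ℕ) : ℤ) ≤ s 0 ∧
        s 0 ≤ Q.canonStart (Q.canonSet ω u) 0 + ((3 ^ i * M₀ : ℕ) : ℤ) ∧
        Q.canonStart (Q.canonSet ω u) 1 - ((3 ^ i * M₀ : ℕ) : ℤ) ≤ s 1 ∧
        s 1 ≤ Q.canonStart (Q.canonSet ω u) 1 + ((3 ^ i * M₀ : ℕ) : ℤ)) →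
      (t 0 ≤ Q.canonStart (Q.canonSet ω u) 0 - 2 * ((3 ^ i * M₀ : ℕ) : ℤ) ∨
        Q.canonStart (Q.canonSet ω u) 0 + 2 * ((3 ^ i * M₀ : ℕ) : ℤ) ≤ t 0 ∨
        t 1 ≤ Q.canonStart (Q.canonSet ω u) 1 - 2 * ((3 ^ i * M₀ : ℕ) : ℤ) ∨
        Q.canonStart (Q.canonSet ω u) 1 + 2 * ((3 ^ i * M₀ : ℕ) : ℤ) ≤ t 1) →
      ¬ PathIn triGraph A s t := by
  obtain ⟨i, hi, hω⟩ := h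
  refine ⟨i, hi, fun hA hs ht hp => ?_⟩
  have hM : 1 ≤ 3 ^ i * M₀ := Nat.one_le_iff_ne_zero.2 (by positivity)
  refine not_pathIn_closed_of_triForcedFrame hM hω (fun z hz => ⟨(hA hz).1.2, ?_⟩) hs ht hp
  rintro (hz' | hz')
  · exact (hA hz).2 hz'
  · exact hz' (hA hz).1.1

/-! ### Protection with an unforced exterior region (fences) -/

variable (Q) in
/-- **Protection / fence frames leaving a region `E` unforced**: for some `i < K`, the frame of
scale `3^i M₀` about the tip is open once the sites of `openStop ω u` and the sites off `U ∪ E`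
are forced open — the sites of `E` (in the application the inner half-box, where Kesten's free
spaces live) keep their own states, so that the part of the frame inside `E` is really open
(Nolin's "small extension of `c_u`" inside the free space). `ProtO = ProtOE ∅` up to
`(U ∪ ∅)ᶜ = Uᶜ`. [cite: Nolin2008, §4.2 Def. 6 and §4.4 proof of Lemma 15 (arXiv 0711.4948: Def. 6, Lemma 14)] -/
def ProtOE (E : Set (Site 2)) (K M₀ : ℕ) (ω : Set (Site 2)) (u : ℕ) : Prop :=
  ∃ i < K, ω ∈ triForcedFrame (↑(Q.openStop ω u) ∪ (↑Q.U ∪ E)ᶜ) (Q.canonStart (Q.canonSet ω u)) (3 ^ i * M₀)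

/-- **Unforced-region frames are rare to miss as well**: `P_p({ω | ¬ ProtOE E K M₀ ω u}) ≤ (1 - c₀⁴)^K`
under the same RSW hypothesis (same proof as `real_not_protO_le`: the forcing set is a function of
the explored data). [cite: Nolin2008, §4.4, proof of Lemma 15 (arXiv 0711.4948: Lemma 14)] -/
theorem real_not_protOE_le (p : unitInterval) (E : Set (Site 2)) (K : ℕ) {M₀ : ℕ} (hM₀ : 1 ≤ M₀) (u : ℕ)
    {c₀ : ℝ} (hc₀ : 0 ≤ c₀) (hc₀1 : c₀ ≤ 1)
    (hrsw : ∀ i < K, c₀ ≤ triLRCrossingProb p (4 * (3 ^ i * M₀)) (3 ^ i * M₀)) :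
    (triSitePercolation p).real {ω | ¬ Q.ProtOE E K M₀ ω u} ≤ (1 - c₀ ^ 4) ^ K := by
  classical
  set A : Finset (Site 2) → Finset (Site 2) → Set (Set (Site 2)) := fun F η =>
    ⋂ i < K, (triForcedFrame (↑F ∪ (↑Q.U ∪ E)ᶜ) (Q.canonStart (Q.canonSet (↑η) u)) (3 ^ i * M₀))ᶜ with hA
  have hsub : {ω : Set (Site 2) | ¬ Q.ProtOE E K M₀ ω u} ⊆
      {ω | ω ∈ A (Q.openStop ω u) ((Q.openStop ω u).filter (· ∈ ω))} := by
    intro ω hω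
    have hagree : ∀ v ∈ Q.openStop ω u, v ∈ ω ↔ v ∈ (↑((Q.openStop ω u).filter (· ∈ ω)) : Set (Site 2)) :=
      fun v hv => by simp [hv]
    have hc : Q.canonSet (↑((Q.openStop ω u).filter (· ∈ ω))) u = Q.canonSet ω u := canonSet_eq_of_agree hagree
    simp only [hA, mem_setOf_eq, mem_iInter, mem_compl_iff, hc]
    intro i hi hmem
    exact hω ⟨i, hi, hmem⟩
  refine (measureReal_mono hsub (measure_ne_top _ _)).trans ?_
  unfold triSitePercolation
  have hε : 0 ≤ (1 - c₀ ^ 4) ^ K := pow_nonneg (sub_nonneg.2 (pow_le_one₀ hc₀ hc₀1)) K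
  refine real_mem_dataEvent_le p (G := Q.U) (Q.isStoppingSet_openStop u) (fun ω => openStop_subset ω u) A
    (fun F η => ?_) hε fun F η => ?_
  · refine ⟨((Finset.range K).biUnion fun i =>
      triSqAnnulusFinset (Q.canonStart (Q.canonSet (↑η) u)) (3 ^ i * M₀) (2 * (3 ^ i * M₀))) \ F,
      Finset.sdiff_disjoint.symm, ?_⟩
    simp only [hA]
    refine DeterminedBy.iInter fun i => DeterminedBy.iInter fun hi => ?_
    have hdet := (determinedBy_triForcedFrame ((↑F : Set (Site 2)) ∪ (↑Q.U ∪ E)ᶜ)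
      (Q.canonStart (Q.canonSet (↑η) u)) (3 ^ i * M₀)).compl
    rw [Finset.coe_filter] at hdet
    refine hdet.mono ?_
    rintro z ⟨hz, hzD⟩
    rw [Finset.coe_sdiff, Finset.coe_biUnion]
    refine ⟨Set.mem_biUnion (Finset.mem_coe.2 (Finset.mem_range.2 hi)) (Finset.mem_coe.2 hz), fun hzF => hzD (Or.inl hzF)⟩
  · have := real_iInter_compl_triForcedFrame_le_pow p ((↑F : Set (Site 2)) ∪ (↑Q.U ∪ E)ᶜ)
      (Q.canonStart (Q.canonSet (↑η) u)) hM₀ K hc₀ hrsw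
    unfold triSitePercolation at this
    simpa only [hA] using this

/-- **Blocking with an unforced region**: on `ProtOE E`, with `i` the protecting scale, no
`𝕋`-path of `ω`-closed sites of `U` avoiding `openStop ω u` joins the `3^i M₀`-box about the tip
to the outside of the `2 · 3^i M₀`-box (the closed sites of `U` avoid the forced set whatever
`E` is). [cite: Nolin2008, §4.4, proof of Lemma 15 (arXiv 0711.4948: Lemma 14)] -/
theorem not_pathIn_closed_of_protOE {E : Set (Site 2)} {K M₀ : ℕ} (hM₀ : 1 ≤ M₀) {ω : Set (Site 2)} {u : ℕ}
    (h : Q.ProtOE E K M₀ ω u) :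
    ∃ i < K, ∀ {A : Set (Site 2)} {s t : Site 2}, A ⊆ (↑Q.U ∩ ωᶜ) \ ↑(Q.openStop ω u) →
      (Q.canonStart (Q.canonSet ω u) 0 - ((3 ^ i * M₀ : ℕ) : ℤ) ≤ s 0 ∧
        s 0 ≤ Q.canonStart (Q.canonSet ω u) 0 + ((3 ^ i * M₀ : ℕ) : ℤ) ∧
        Q.canonStart (Q.canonSet ω u) 1 - ((3 ^ i * M₀ : ℕ) : ℤ) ≤ s 1 ∧
        s 1 ≤ Q.canonStart (Q.canonSet ω u) 1 + ((3 ^ i * M₀ : ℕ) : ℤ)) →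
      (t 0 ≤ Q.canonStart (Q.canonSet ω u) 0 - 2 * ((3 ^ i * M₀ : ℕ) : ℤ) ∨
        Q.canonStart (Q.canonSet ω u) 0 + 2 * ((3 ^ i * M₀ : ℕ) : ℤ) ≤ t 0 ∨
        t 1 ≤ Q.canonStart (Q.canonSet ω u) 1 - 2 * ((3 ^ i * M₀ : ℕ) : ℤ) ∨
        Q.canonStart (Q.canonSet ω u) 1 + 2 * ((3 ^ i * M₀ : ℕ) : ℤ) ≤ t 1) →
      ¬ PathIn triGraph A s t := by
  obtain ⟨i, hi, hω⟩ := h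
  refine ⟨i, hi, fun hA hs ht hp => ?_⟩
  have hM : 1 ≤ 3 ^ i * M₀ := Nat.one_le_iff_ne_zero.2 (by positivity)
  refine not_pathIn_closed_of_triForcedFrame hM hω (fun z hz => ⟨(hA hz).1.2, ?_⟩) hs ht hp
  rintro (hz' | hz')
  · exact (hA hz).2 hz'
  · exact hz' (Or.inl (hA hz).1.1)

end TriQuad

end Literature.Probability.Percolation
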